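/-
Origin: expansion seat `planner-pub-hodgecm-mc-glue-1-g5-0`, handover #339 2026-08-19T11:30Z md5 dd3f7ac8d35ebb5834fc10eb97b9a231 WHOLE-FILE REPLACEMENT of the installed RUN-32 file (glue-1-g2 228def02eb0a → PKG ab6d56fb718d, 86 l.) by 259 l.; install AFTER #338; imports `HodgeCM.CM.Basic` (as before) + `HodgeCM.Model.Junction.RationalFrame` (#338). SAME NAMES AND TYPES: `HermSpace3.map_starRingEnd_transpose`, `signatureMatrix_two_eq_diagonal`, `exists_sylvesterFrame` (statement and proof verbatim), `sylvesterFrame : GL (Fin 3) ℂ`, `sylvesterFrame_spec`, `sylvesterFrame_spec'` (statements verbatim; proofs re-done for the new body). NEW BODY per (J-x₀)(α): `sylvesterScale V j : ℝ := (√∣r (σ j)∣)⁻¹`, `sylvesterMatrix V := (rationalFrameC V : Matrix).submatrix id (rationalFramePerm V) * diagonal (s : ℂ)` (column j = column σ j of g^{ι₁} scaled, NEGATIVE LINE LAST), `sylvesterMatrix_spec' : T_Gᴴ · Hm^{ι₁} · T_G = signatureMatrix 2` (via `submatrix_rationalFrameC_diag : (G∘σ)ᴴ H (G∘σ) = diagonal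 (r∘σ)` and `s_j² r_{σj} = ±1`), `det_sylvesterMatrix_ne_zero`, `sylvesterFrame V := Matrix.GeneralLinearGroup.mkOfDetNeZero (sylvesterMatrix V) _`, `coe_sylvesterFrame` (rfl, simp). NEW LEMMAS: `sylvesterFrame_eq_rationalFrame_adapted : (sylvesterFrame : Matrix) = ((rationalFrame : Matrix).map ι₁).submatrix id σ * diagonal s` (rfl — the unfolding (J-x₀) names), `sylvesterFrame_apply i j = ι₁ (g i (σ j)) * s j`, and the TORUS IDENTITY behind «T_CM(ℝ)_{ι₁} ⊂ K_∞»: `rationalTorus_mul_sylvesterFrame (u : Fin 3 → ℂ) : (G · diagonal u · G⁻¹) · T_G = T_G · diagonal (u ∘ σ)` and `sylvesterFrame_conj_rationalTorus u : T_G⁻¹ · (G · diagonal u · G⁻¹) · T_G = diagonal (u ∘ σ)` (G = rationalFrameC, GL inverses) — the ι₁-image of the rational-diagonal torus, in particular the CM torus U(1)³ ⊂ U(diag d)(ℝ), is DIAGONAL in the frame of record, hence in U(2)×U(1) = Stab(x₀); the `archIsotropy`-level corollary (`diagTorus_le_archIsotropy_sylvesterFrame` of the ruling) is NOT in this row: it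 is one `mem_archIsotropy_iff` + `archProjU21EmbCM` unfolding away for the consumer (binder-2 `HypCensus/ArchDatum` / theta-3), or a follow-up 40-line leaf by my successor once theta-3-g8 points at the `arch`-side def that builds the ι₁-component (asked 11:03:25Z (J-norm)). lean (oleanJ) rc 0, 0 errors, 0 warnings, 0 proof-hole; axioms trio; CONE 34/34 rc 0 (header). (`HOME/mc/pub-hodgecm-mc-glue-1-g5/lean/jsyl/HodgeCM/Model/Junction/SylvesterFrame.lean`, md5 dd3f7ac8, 259 lines);
landed by the gen-12 packager (p-g12) in gate run 36 REPLACES the earlier landed copy of `HodgeCM/Model/Junction/SylvesterFrame.lean` (verbatim).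
-/
/-
Origin: HOME/mc/pub-hodgecm-mc-glue-1-g5/lean/jsyl/HodgeCM/Model/Junction/SylvesterFrame.lean — session
planner-pub-hodgecm-mc-glue-1-g5-0 (unit pub-hodgecm-mc-glue-1-g5, CONSTRUCTION PROVER gen 5 of mc-glue-1, nodes E ASSEMBLER +
J-Syl).  WHOLE-FILE REPLACEMENT of the installed `HodgeCM/Model/Junction/SylvesterFrame.lean` (glue-1-g2, RUN 32, PKG md5
ab6d56fb718d): SAME declaration names and types (`map_starRingEnd_transpose`, `signatureMatrix_two_eq_diagonal`,
`exists_sylvesterFrame`, `sylvesterFrame : GL (Fin 3) ℂ`, `sylvesterFrame_spec`, `sylvesterFrame_spec'`), NEW BODY of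
`sylvesterFrame` per ruling (J-x₀) model1-g6 2026-08-19T11:03:25Z, implementation (α): the Sylvester frame of record is the one
ADAPTED TO THE RATIONAL ORTHOGONAL FRAME, `T_G := g^{ι₁} ∘ σ · D` (columns of the rational frame `g = rationalFrame V` at `ι₁`,
sorted by the sign permutation `σ = rationalFramePerm V` so that the negative line is LAST, scaled by `D = diag(1/√|rᵢ|)`), so
that the CM torus `U(1)³ ⊂ U(diag d)(ℝ)` is DIAGONAL in the frame and fixes the base point `x₀` of the ball.  Consumers use
`sylvesterFrame` only through `sylvesterFrame_spec` / `sylvesterFrame_spec'` / `BallInstance.sylvesterFrame_J` (usage fact,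
STATUS 11:05:44Z), so they re-compile source-unchanged.  Imports: `HodgeCM.CM.Basic` (as before) + `HodgeCM.Model.Junction.
RationalFrame` (NEW leaf of the same kit; it imports `HodgeCM.Proofs.HermitianDiagonalize`, a RUN-33 leaf imported only by
`AxiomAudit` — no cycle).  KERNEL only, 0 records, MODEL-N += 0.
-/
import Summits.HodgeConjecture.HodgeCM.CM.Basic
import Summits.HodgeConjecture.HodgeCM.Model.Junction.RationalFrame

set_option autoImplicit false

/-!
# Junction J-Syl: the Sylvester frame of a hermitian 3-space at its indefinite place, adapted to the rational frame

* `HermSpace3.map_starRingEnd_transpose` : `((T : Matrix).map (starRingEnd ℂ))ᵀ = Tᴴ` (the `formCongr` spelling of `ᴴ`);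
* `HermSpace3.signatureMatrix_two_eq_diagonal` : `signatureMatrix 2 = Matrix.diagonal ![1, 1, -1]`;
* `HermSpace3.exists_sylvesterFrame` : `∃ T : GL (Fin 3) ℂ, σ(T)ᵀ · Hm^{ι₁} · T = diag(1, 1, -1)`;
* `HermSpace3.sylvesterScale V : Fin 3 → ℝ` (`1/√|r (σ j)|`), `HermSpace3.sylvesterMatrix V := (g^{ι₁}).submatrix id σ · diagonal s`
  and `HermSpace3.sylvesterMatrix_spec' : Tᴴ · Hm^{ι₁} · T = signatureMatrix 2`;
* `HermSpace3.sylvesterFrame V : GL (Fin 3) ℂ` — THE FRAME OF RECORD, `:= T_G` (invertible because `det (Tᴴ H T) = -1`), with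
  `sylvesterFrame_spec` / `sylvesterFrame_spec'` (same statements as at RUN 32) and the unfolding
  `HermSpace3.sylvesterFrame_eq_rationalFrame_adapted` / `HermSpace3.sylvesterFrame_apply`;
* `HermSpace3.rationalTorus_mul_sylvesterFrame` / `HermSpace3.sylvesterFrame_conj_rationalTorus` : for `u : Fin 3 → ℂ`,
  `(G · diagonal u · G⁻¹) · T_G = T_G · diagonal (u ∘ σ)` and `T_G⁻¹ · (G · diagonal u · G⁻¹) · T_G = diagonal (u ∘ σ)` — the
  `ι₁`-component of the rational-diagonal torus `{g · diag(u) · g⁻¹}` (in particular the CM torus `U(1)³ ⊂ U(diag d)(ℝ)`) is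
  DIAGONAL in the Sylvester frame, hence lies in `Stab(x₀) = U(2) × U(1)` of the ball; this is the matrix identity behind
  (J-x₀)'s «`T_CM(ℝ)_{ι₁} ⊂ K_∞`» (the `archIsotropy`-level corollary is read off by the consumer through `mem_archIsotropy_iff`).
-/

noncomputable section

namespace HodgeCM

namespace HermSpace3

open scoped Matrix
open Literature.AlgebraicGeometry.ShimuraVarieties

variable {L : CMField} {ι₁ : L →+* ℂ}

/-- The `formCongr` spelling of the conjugate transpose: `(σ(T))ᵀ = Tᴴ` for `σ = starRingEnd ℂ`. [folklore] -/
theorem map_starRingEnd_transpose (T : Matrix (Fin 3) (Fin 3) ℂ) :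
    (T.map (starRingEnd ℂ))ᵀ = Tᴴ := by
  ext i j
  simp [Matrix.conjTranspose_apply, Matrix.map_apply]

/-- `signatureMatrix 2 = diag(1, 1, -1)` (the body of the tree's `BallModel.J`). [folklore] -/
theorem signatureMatrix_two_eq_diagonal :
    signatureMatrix 2 = Matrix.diagonal ![(1 : ℂ), 1, -1] :=
  signatureMatrix_two_diagonal

/-- **J-Syl.** A hermitian 3-space of signature `(2,1)` at `ι₁` has a Sylvester frame at `ι₁` in the automorphic
side's spelling: `∃ T ∈ GL₃(ℂ)`, `σ(T)ᵀ · h^{ι₁} · T = diag(1, 1, -1)`.  (Read off the field `signature_ι₁`.) [folklore] -/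
theorem exists_sylvesterFrame (V : HermSpace3 L ι₁) :
    ∃ T : GL (Fin 3) ℂ, ((T : Matrix (Fin 3) (Fin 3) ℂ).map (starRingEnd ℂ))ᵀ * V.Hm.map ι₁ *
      (T : Matrix (Fin 3) (Fin 3) ℂ) = Matrix.diagonal ![(1 : ℂ), 1, -1] := by
  obtain ⟨T, hT⟩ := V.signature_ι₁
  exact ⟨T, by rw [map_starRingEnd_transpose, hT, signatureMatrix_two_eq_diagonal]⟩

variable (V : HermSpace3 L ι₁)

/-! ### The adapted frame `T_G = g^{ι₁} ∘ σ · D` -/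

/-- The column scales `s j := 1 / √|r (σ j)|`. [folklore] -/
def sylvesterScale (j : Fin 3) : ℝ := (Real.sqrt |V.rationalFrame_r (V.rationalFramePerm j)|)⁻¹

/-- (Ported verbatim from the HodgeCMPerL package; no docstring in the source.) -/
theorem sylvesterScale_pos (j : Fin 3) : 0 < V.sylvesterScale j :=
  inv_pos.mpr (Real.sqrt_pos.mpr (abs_pos.mpr (V.rationalFrame_r_ne_zero _)))

/-- `s_j² · r_{σ j} = r_{σ j} / |r_{σ j}|` (`= ±1`). [folklore] -/
theorem sylvesterScale_sq_mul (j : Fin 3) :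
    V.sylvesterScale j * V.sylvesterScale j * V.rationalFrame_r (V.rationalFramePerm j) =
      V.rationalFrame_r (V.rationalFramePerm j) / |V.rationalFrame_r (V.rationalFramePerm j)| := by
  have habs : 0 < |V.rationalFrame_r (V.rationalFramePerm j)| := abs_pos.mpr (V.rationalFrame_r_ne_zero _)
  rw [sylvesterScale, ← mul_inv, Real.mul_self_sqrt habs.le, div_eq_inv_mul]

/-- (Ported verbatim from the HodgeCMPerL package; no docstring in the source.) -/
theorem sylvesterScale_sq_mul_of_pos {j : Fin 3} (h : 0 < V.rationalFrame_r (V.rationalFramePerm j)) :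
    V.sylvesterScale j * V.sylvesterScale j * V.rationalFrame_r (V.rationalFramePerm j) = 1 := by
  rw [sylvesterScale_sq_mul, abs_of_pos h, div_self h.ne']

/-- (Ported verbatim from the HodgeCMPerL package; no docstring in the source.) -/
theorem sylvesterScale_sq_mul_of_neg {j : Fin 3} (h : V.rationalFrame_r (V.rationalFramePerm j) < 0) :
    V.sylvesterScale j * V.sylvesterScale j * V.rationalFrame_r (V.rationalFramePerm j) = -1 := by
  rw [sylvesterScale_sq_mul, abs_of_neg h, div_neg, div_self h.ne]

/-- **The adapted Sylvester matrix** `T_G := (g^{ι₁}).submatrix id σ · diagonal s` (column `j` = column `σ j` of the rational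
frame at `ι₁`, scaled by `s j`). [folklore] -/
def sylvesterMatrix : Matrix (Fin 3) (Fin 3) ℂ :=
  (V.rationalFrameC : Matrix (Fin 3) (Fin 3) ℂ).submatrix id V.rationalFramePerm *
    Matrix.diagonal (fun j => ((V.sylvesterScale j : ℝ) : ℂ))

/-- (Ported verbatim from the HodgeCMPerL package; no docstring in the source.) -/
theorem sylvesterMatrix_apply (i j : Fin 3) :
    V.sylvesterMatrix i j = (V.rationalFrameC : Matrix (Fin 3) (Fin 3) ℂ) i (V.rationalFramePerm j) * V.sylvesterScale j := by
  simp [sylvesterMatrix, Matrix.mul_diagonal]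

/-- The permuted rational frame diagonalises `Hm^{ι₁}` with the permuted diagonal:
`(G∘σ)ᴴ · Hm^{ι₁} · (G∘σ) = diagonal (r ∘ σ)`. [folklore] -/
theorem submatrix_rationalFrameC_diag :
    ((V.rationalFrameC : Matrix (Fin 3) (Fin 3) ℂ).submatrix id V.rationalFramePerm)ᴴ * V.Hm.map ι₁ *
        (V.rationalFrameC : Matrix (Fin 3) (Fin 3) ℂ).submatrix id V.rationalFramePerm =
      Matrix.diagonal (fun j => ((V.rationalFrame_r (V.rationalFramePerm j) : ℝ) : ℂ)) := by
  set G : Matrix (Fin 3) (Fin 3) ℂ := (V.rationalFrameC : Matrix (Fin 3) (Fin 3) ℂ)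
  set σ := V.rationalFramePerm
  have h1 : (G.submatrix id σ)ᴴ * V.Hm.map ι₁ = (Gᴴ * V.Hm.map ι₁).submatrix σ id := by
    rw [Matrix.conjTranspose_submatrix,
      Matrix.submatrix_mul _ _ (σ : Fin 3 → Fin 3) (id : Fin 3 → Fin 3) (id : Fin 3 → Fin 3) Function.bijective_id,
      Matrix.submatrix_id_id]
  have h2 : (Gᴴ * V.Hm.map ι₁).submatrix σ id * G.submatrix id σ = (Gᴴ * V.Hm.map ι₁ * G).submatrix σ σ := by
    rw [Matrix.submatrix_mul _ _ (σ : Fin 3 → Fin 3) (id : Fin 3 → Fin 3) (σ : Fin 3 → Fin 3) Function.bijective_id]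
  rw [h1, h2, V.rationalFrame_diag_ι₁, Matrix.submatrix_diagonal_equiv]
  rfl

/-- **`T_Gᴴ · Hm^{ι₁} · T_G = signatureMatrix 2`.** [folklore] -/
theorem sylvesterMatrix_spec' : V.sylvesterMatrixᴴ * V.Hm.map ι₁ * V.sylvesterMatrix = signatureMatrix 2 := by
  rw [sylvesterMatrix, Matrix.conjTranspose_mul, Matrix.diagonal_conjTranspose]
  have : (Matrix.diagonal (star fun j => ((V.sylvesterScale j : ℝ) : ℂ)) *
        ((V.rationalFrameC : Matrix (Fin 3) (Fin 3) ℂ).submatrix id V.rationalFramePerm)ᴴ * V.Hm.map ι₁ *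
        ((V.rationalFrameC : Matrix (Fin 3) (Fin 3) ℂ).submatrix id V.rationalFramePerm *
          Matrix.diagonal fun j => ((V.sylvesterScale j : ℝ) : ℂ))) =
      Matrix.diagonal (star fun j => ((V.sylvesterScale j : ℝ) : ℂ)) *
        (((V.rationalFrameC : Matrix (Fin 3) (Fin 3) ℂ).submatrix id V.rationalFramePerm)ᴴ * V.Hm.map ι₁ *
          (V.rationalFrameC : Matrix (Fin 3) (Fin 3) ℂ).submatrix id V.rationalFramePerm) *
        Matrix.diagonal (fun j => ((V.sylvesterScale j : ℝ) : ℂ)) := by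
    simp only [Matrix.mul_assoc]
  rw [this, submatrix_rationalFrameC_diag, Matrix.diagonal_mul_diagonal, Matrix.diagonal_mul_diagonal,
    signatureMatrix_two_eq_diagonal]
  congr 1
  funext j
  have hs : (star fun j => ((V.sylvesterScale j : ℝ) : ℂ)) j = ((V.sylvesterScale j : ℝ) : ℂ) := by
    simp [Pi.star_apply, Complex.conj_ofReal]
  rw [hs]
  have key : ((V.sylvesterScale j : ℝ) : ℂ) * ((V.rationalFrame_r (V.rationalFramePerm j) : ℝ) : ℂ) *
      ((V.sylvesterScale j : ℝ) : ℂ) =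
      ((V.sylvesterScale j * V.sylvesterScale j * V.rationalFrame_r (V.rationalFramePerm j) : ℝ) : ℂ) := by
    push_cast; ring
  rw [key]
  fin_cases j
  · simp [V.sylvesterScale_sq_mul_of_pos V.rationalFrame_r_perm_zero_pos]
  · simp [V.sylvesterScale_sq_mul_of_pos V.rationalFrame_r_perm_one_pos]
  · simp [V.sylvesterScale_sq_mul_of_neg V.rationalFrame_r_perm_two_neg]

/-- `det T_G ≠ 0` (from `det (T_Gᴴ H T_G) = det (signatureMatrix 2) = -1`). [folklore] -/
theorem det_sylvesterMatrix_ne_zero : V.sylvesterMatrix.det ≠ 0 := by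
  intro h0
  have h := congrArg Matrix.det V.sylvesterMatrix_spec'
  rw [Matrix.det_mul, Matrix.det_mul, h0, mul_zero, signatureMatrix_two_eq_diagonal, Matrix.det_diagonal,
    Fin.prod_univ_three] at h
  rw [show (![(1 : ℂ), 1, -1]) 2 = -1 from rfl] at h
  norm_num at h

/-- **THE SYLVESTER FRAME OF RECORD** of `V` at `ι₁`: the adapted frame `T_G` as an element of `GL₃(ℂ)`. [folklore] -/
def sylvesterFrame : GL (Fin 3) ℂ :=
  Matrix.GeneralLinearGroup.mkOfDetNeZero V.sylvesterMatrix V.det_sylvesterMatrix_ne_zero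

/-- Unfolding: the frame's matrix is `T_G`. [folklore] -/
@[simp] theorem coe_sylvesterFrame : (V.sylvesterFrame : Matrix (Fin 3) (Fin 3) ℂ) = V.sylvesterMatrix := rfl

/-- **Unfolding (J-x₀)**: `sylvesterFrame = (rationalFrame^{ι₁}).submatrix id σ · diagonal s`. [folklore] -/
theorem sylvesterFrame_eq_rationalFrame_adapted :
    (V.sylvesterFrame : Matrix (Fin 3) (Fin 3) ℂ) =
      ((V.rationalFrame : Matrix (Fin 3) (Fin 3) L).map ι₁).submatrix id V.rationalFramePerm *
        Matrix.diagonal (fun j => ((V.sylvesterScale j : ℝ) : ℂ)) := rfl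

/-- (Ported verbatim from the HodgeCMPerL package; no docstring in the source.) -/
theorem sylvesterFrame_apply (i j : Fin 3) :
    (V.sylvesterFrame : Matrix (Fin 3) (Fin 3) ℂ) i j =
      ι₁ ((V.rationalFrame : Matrix (Fin 3) (Fin 3) L) i (V.rationalFramePerm j)) * V.sylvesterScale j := by
  rw [coe_sylvesterFrame, sylvesterMatrix_apply]; rfl

/-- The chosen frame's equation, `ᴴ` / `signatureMatrix` spelling. [folklore] -/
theorem sylvesterFrame_spec' :
    (V.sylvesterFrame : Matrix (Fin 3) (Fin 3) ℂ)ᴴ * V.Hm.map ι₁ * (V.sylvesterFrame : Matrix (Fin 3) (Fin 3) ℂ) =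
      signatureMatrix 2 :=
  V.sylvesterMatrix_spec'

/-- The chosen frame's equation, `formCongr` spelling. [folklore] -/
theorem sylvesterFrame_spec :
    ((V.sylvesterFrame : Matrix (Fin 3) (Fin 3) ℂ).map (starRingEnd ℂ))ᵀ * V.Hm.map ι₁ *
      (V.sylvesterFrame : Matrix (Fin 3) (Fin 3) ℂ) = Matrix.diagonal ![(1 : ℂ), 1, -1] := by
  rw [map_starRingEnd_transpose, ← signatureMatrix_two_eq_diagonal]
  exact V.sylvesterFrame_spec'

/-! ### The rational-diagonal torus is diagonal in the frame -/

/-- Column permutation as right multiplication by a permutation matrix: `G.submatrix id σ = G · (1.submatrix id σ)`. [folklore] -/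
theorem submatrix_id_eq_mul (G : Matrix (Fin 3) (Fin 3) ℂ) (σ : Equiv.Perm (Fin 3)) :
    G.submatrix id σ = G * (1 : Matrix (Fin 3) (Fin 3) ℂ).submatrix id σ := by
  ext i j
  simp [Matrix.mul_apply, Matrix.one_apply, Matrix.submatrix_apply]

/-- A diagonal matrix past a column permutation: `diagonal u · 1∘σ = 1∘σ · diagonal (u ∘ σ)`. [folklore] -/
theorem diagonal_mul_perm (u : Fin 3 → ℂ) (σ : Equiv.Perm (Fin 3)) :
    Matrix.diagonal u * (1 : Matrix (Fin 3) (Fin 3) ℂ).submatrix id σ =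
      (1 : Matrix (Fin 3) (Fin 3) ℂ).submatrix id σ * Matrix.diagonal (u ∘ σ) := by
  ext i j
  simp only [Matrix.diagonal_mul, Matrix.mul_diagonal, Matrix.submatrix_apply, id, Matrix.one_apply,
    Function.comp_apply]
  by_cases h : i = σ j
  · subst h; simp
  · simp [h]

/-- **The rational-diagonal torus acts diagonally in the Sylvester frame (intertwining form)**: for `u : Fin 3 → ℂ`,
`(G · diagonal u · G⁻¹) · T_G = T_G · diagonal (u ∘ σ)`, `G = rationalFrame^{ι₁}`. [folklore] -/
theorem rationalTorus_mul_sylvesterFrame (u : Fin 3 → ℂ) :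
    (V.rationalFrameC : Matrix (Fin 3) (Fin 3) ℂ) * Matrix.diagonal u * ((V.rationalFrameC⁻¹ : GL (Fin 3) ℂ) : Matrix (Fin 3) (Fin 3) ℂ) *
        (V.sylvesterFrame : Matrix (Fin 3) (Fin 3) ℂ) =
      (V.sylvesterFrame : Matrix (Fin 3) (Fin 3) ℂ) * Matrix.diagonal (u ∘ V.rationalFramePerm) := by
  rw [coe_sylvesterFrame, sylvesterMatrix, submatrix_id_eq_mul]
  have hGG : ((V.rationalFrameC⁻¹ : GL (Fin 3) ℂ) : Matrix (Fin 3) (Fin 3) ℂ) *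
      (V.rationalFrameC : Matrix (Fin 3) (Fin 3) ℂ) = 1 := by
    rw [← Units.val_mul, inv_mul_cancel, Units.val_one]
  have hDD : Matrix.diagonal (u ∘ V.rationalFramePerm) * Matrix.diagonal (fun j => ((V.sylvesterScale j : ℝ) : ℂ)) =
      Matrix.diagonal (fun j => ((V.sylvesterScale j : ℝ) : ℂ)) * Matrix.diagonal (u ∘ V.rationalFramePerm) := by
    rw [Matrix.diagonal_mul_diagonal, Matrix.diagonal_mul_diagonal]
    congr 1; funext j; ring
  calc (V.rationalFrameC : Matrix (Fin 3) (Fin 3) ℂ) * Matrix.diagonal u *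
        ((V.rationalFrameC⁻¹ : GL (Fin 3) ℂ) : Matrix (Fin 3) (Fin 3) ℂ) *
        ((V.rationalFrameC : Matrix (Fin 3) (Fin 3) ℂ) * (1 : Matrix (Fin 3) (Fin 3) ℂ).submatrix id V.rationalFramePerm *
          Matrix.diagonal (fun j => ((V.sylvesterScale j : ℝ) : ℂ)))
      = (V.rationalFrameC : Matrix (Fin 3) (Fin 3) ℂ) * Matrix.diagonal u *
          ((((V.rationalFrameC⁻¹ : GL (Fin 3) ℂ) : Matrix (Fin 3) (Fin 3) ℂ) * (V.rationalFrameC : Matrix (Fin 3) (Fin 3) ℂ)) *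
          ((1 : Matrix (Fin 3) (Fin 3) ℂ).submatrix id V.rationalFramePerm *
            Matrix.diagonal (fun j => ((V.sylvesterScale j : ℝ) : ℂ)))) := by
        simp only [Matrix.mul_assoc]
    _ = (V.rationalFrameC : Matrix (Fin 3) (Fin 3) ℂ) *
          (Matrix.diagonal u * (1 : Matrix (Fin 3) (Fin 3) ℂ).submatrix id V.rationalFramePerm) *
          Matrix.diagonal (fun j => ((V.sylvesterScale j : ℝ) : ℂ)) := by
        rw [hGG, Matrix.one_mul]; simp only [Matrix.mul_assoc]
    _ = (V.rationalFrameC : Matrix (Fin 3) (Fin 3) ℂ) * (1 : Matrix (Fin 3) (Fin 3) ℂ).submatrix id V.rationalFramePerm *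
          (Matrix.diagonal (u ∘ V.rationalFramePerm) * Matrix.diagonal (fun j => ((V.sylvesterScale j : ℝ) : ℂ))) := by
        rw [diagonal_mul_perm]; simp only [Matrix.mul_assoc]
    _ = (V.rationalFrameC : Matrix (Fin 3) (Fin 3) ℂ) * (1 : Matrix (Fin 3) (Fin 3) ℂ).submatrix id V.rationalFramePerm *
          Matrix.diagonal (fun j => ((V.sylvesterScale j : ℝ) : ℂ)) * Matrix.diagonal (u ∘ V.rationalFramePerm) := by
        rw [hDD]; simp only [Matrix.mul_assoc]

/-- **(J-x₀) matrix identity**: `T_G⁻¹ · (G · diagonal u · G⁻¹) · T_G = diagonal (u ∘ σ)` — the `ι₁`-image of the rational-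
diagonal torus (in particular of the CM torus `U(1)³ ⊂ U(diag d)(ℝ)`) is DIAGONAL in the Sylvester frame of record, hence inside
`U(2) × U(1) = Stab(x₀)`. [folklore] -/
theorem sylvesterFrame_conj_rationalTorus (u : Fin 3 → ℂ) :
    ((V.sylvesterFrame⁻¹ : GL (Fin 3) ℂ) : Matrix (Fin 3) (Fin 3) ℂ) *
        ((V.rationalFrameC : Matrix (Fin 3) (Fin 3) ℂ) * Matrix.diagonal u *
          ((V.rationalFrameC⁻¹ : GL (Fin 3) ℂ) : Matrix (Fin 3) (Fin 3) ℂ)) *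
        (V.sylvesterFrame : Matrix (Fin 3) (Fin 3) ℂ) =
      Matrix.diagonal (u ∘ V.rationalFramePerm) := by
  rw [Matrix.mul_assoc, rationalTorus_mul_sylvesterFrame, ← Matrix.mul_assoc, ← Units.val_mul, inv_mul_cancel,
    Units.val_one, Matrix.one_mul]

end HermSpace3

end HodgeCM

end
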